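import Summits.ValiantsHypothesis.ValiantsHypothesis.Theorems.KPlusLogSqLawTropicalBSplitDefs
import Summits.ValiantsHypothesis.ValiantsHypothesis.Theorems.KPlusLogSqLawTropicalBOneCutEntries

/-!
# Route `KPlusLogSqLaw`, crux `TropicalB` (stmt-ValiantsHypothesis-19771) — ONE CUT IS UNIVERSAL, part 3: the menu lift PER DESIGN
# (existential form with degree control), the reusable API of the normal form `…TropicalBOneCut`

HONEST FRAMING.  Helper file (seat val-sym-trop-p1 g16, cell `pub-symmetroid`, 2026-08-28) toward the registered stubs `stub_tropThin` /
`stub_tropFat` of `Cruxes/TropicalB/Lines/birth.lean` (crux `Summit.ValiantsHypothesis.ValiantsHypothesis.Theses.KPlusLogSqLaw.TropicalB`,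
item `stmt-ValiantsHypothesis-19771`, route `KPlusLogSqLaw`; `--supports … --as helper`).  Re-packaging of the gadget of `…TropicalBOneCut`
(p608361, whose `OneCut.tropRowD_of_strip` is the class-level corollary) as a statement about ONE design, so that it composes with other
reductions (e.g. `…TropicalBColumnFanout`); it bounds nothing for `TropicalB` and bears on neither `WeakLifting`, the doors, `MatrixDescartes`
(stmt-ValiantsHypothesis-18050) nor VP ≠ VNP.

* `exists_menu_lift` — for every design `(d, v, ε)` of format `(m, K)` there is a design `(d', v', ε')` of format `((m+1)·m, K+1)` which is a
  MENU design of width `m` ((1) columns `≥ m` carry only exponent-`0` classes, (2) and only valuation `0`, (3) every row is available to at most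
  one column `< m`, (4) columns `≥ m` have `≤ 2` present rows), whose strip column `c < m` has at most as many present rows as the original
  column `c` (DEGREE CONTROL), and whose unsigned row bounds transfer down: `DesignRowD d' v' ε' B → DesignRowD d v ε B` for every `B`.
The construction and the proof are those of part 2 (spare rows, cells, strip columns with private menus, parking slots; lift / descent of
present terms with equal weights); see the header of `…TropicalBOneCut` for the dictionary.  [folklore] (gadget)
-/

set_option linter.dupNamespace false
set_option autoImplicit false

namespace Summit.ValiantsHypothesis.ValiantsHypothesis.Theorems.KPlusLogSqLaw

open Summit.ValiantsHypothesis.ValiantsHypothesis.Theorems.MatrixDescartes.Negative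
open Summit.ValiantsHypothesis.ValiantsHypothesis.Theorems.LacunarySymmetroidMatrixDescartes
open scoped BigOperators
open Finset
namespace OneCut

/-- **The menu lift of a design** (existential, with degree control and transfer of unsigned row bounds). [folklore] -/
theorem exists_menu_lift (m K : ℕ) (d : Fin K → ℕ) (v ε : Fin m → Fin m → Fin K → ℤ) :
    ∃ (d' : Fin (K + 1) → ℕ) (v' ε' : Fin ((m + 1) * m) → Fin ((m + 1) * m) → Fin (K + 1) → ℤ),
      (∀ (a b : Fin ((m + 1) * m)) (l : Fin (K + 1)), m ≤ (b : ℕ) → ε' a b l ≠ 0 → d' l = 0) ∧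
      (∀ (a b : Fin ((m + 1) * m)) (l : Fin (K + 1)), m ≤ (b : ℕ) → v' a b l = 0) ∧
      (∀ (a b b' : Fin ((m + 1) * m)) (l l' : Fin (K + 1)), (b : ℕ) < m → (b' : ℕ) < m →
        ε' a b l ≠ 0 → ε' a b' l' ≠ 0 → b = b') ∧
      (∀ b : Fin ((m + 1) * m), m ≤ (b : ℕ) → (Finset.univ.filter fun a => ∃ l, ε' a b l ≠ 0).card ≤ 2) ∧
      (∀ (b : Fin ((m + 1) * m)) (hb : (b : ℕ) < m),
        (Finset.univ.filter fun a => ∃ l, ε' a b l ≠ 0).card ≤ (Finset.univ.filter fun a => ∃ l, ε a ⟨b, hb⟩ l ≠ 0).card) ∧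
      (∀ B : ℕ, DesignRowD d' v' ε' B → DesignRowD d v ε B) := by
  classical
  -- the structured index type and its transport: `(t, a) ↦ a + m·t`, so the strip columns `(0, c)` are the indices `< m`
  set e : Fin (m + 1) × Fin m ≃ Fin ((m + 1) * m) := finProdFinEquiv with he
  have he_val : ∀ u : Fin (m + 1) × Fin m, ((e u : Fin ((m + 1) * m)) : ℕ) = (u.2 : ℕ) + m * (u.1 : ℕ) := fun u => rfl
  -- the big design on the structured index type
  obtain ⟨E, hE⟩ : ∃ E : Fin (m + 1) × Fin m → Fin (m + 1) × Fin m → Fin (K + 1) → ℤ, ∀ r c l, E r c l =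
      (if (c.1 : ℕ) = 0 then (if (r.1 : ℕ) = (c.2 : ℕ) + 1 then (if h : (l : ℕ) < K then ε r.2 c.2 ⟨l, h⟩ else 0) else 0)
       else if r.2 = c.2 ∧ ((r.1 : ℕ) = 0 ∨ r.1 = c.1) ∧ l = Fin.last K then 1 else 0) := ⟨_, fun _ _ _ => rfl⟩
  obtain ⟨V, hV⟩ : ∃ V : Fin (m + 1) × Fin m → Fin (m + 1) × Fin m → Fin (K + 1) → ℤ, ∀ r c l, V r c l =
      (if h : (c.1 : ℕ) = 0 ∧ (r.1 : ℕ) = (c.2 : ℕ) + 1 ∧ (l : ℕ) < K then v r.2 c.2 ⟨l, h.2.2⟩ else 0) :=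
    ⟨_, fun _ _ _ => rfl⟩
  obtain ⟨D, hD⟩ : ∃ D : Fin (K + 1) → ℕ, ∀ l, D l = if h : (l : ℕ) < K then d ⟨l, h⟩ else 0 := ⟨_, fun _ => rfl⟩
  have hDcast : ∀ l : Fin K, D (Fin.castSucc l) = d l := by intro l; rw [hD, dif_pos (by simp)]; rfl
  have hDlast : D (Fin.last K) = 0 := by rw [hD, dif_neg (by simp)]
  -- the transported design
  let ε' : Fin ((m + 1) * m) → Fin ((m + 1) * m) → Fin (K + 1) → ℤ := fun x y l => E (e.symm x) (e.symm y) l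
  let v' : Fin ((m + 1) * m) → Fin ((m + 1) * m) → Fin (K + 1) → ℤ := fun x y l => V (e.symm x) (e.symm y) l
  -- the index of a column determines its structured coordinates
  have hcoord : ∀ y : Fin ((m + 1) * m), (y : ℕ) = ((e.symm y).2 : ℕ) + m * ((e.symm y).1 : ℕ) := by
    intro y; rw [← he_val (e.symm y), Equiv.apply_symm_apply]
  have hfirst_of_lt : ∀ y : Fin ((m + 1) * m), (y : ℕ) < m → ((e.symm y).1 : ℕ) = 0 := by
    intro y hy
    rcases Nat.eq_zero_or_pos ((e.symm y).1 : ℕ) with h0 | h0; · exact h0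
    have h1 := hcoord y; have : m ≤ m * ((e.symm y).1 : ℕ) := Nat.le_mul_of_pos_right m h0; omega
  have hfirst_of_le : ∀ y : Fin ((m + 1) * m), m ≤ (y : ℕ) → ((e.symm y).1 : ℕ) ≠ 0 := by
    intro y hy h0
    have h1 := hcoord y; have hzero : m * ((e.symm y).1 : ℕ) = 0 := by rw [h0, Nat.mul_zero]
    have hlt := (e.symm y).2.isLt; omega
  -- (i) the strip property: columns of index `≥ m` carry only the last class, of exponent `0`
  have hstrip : ∀ (x y : Fin ((m + 1) * m)) (l : Fin (K + 1)), m ≤ (y : ℕ) → ε' x y l ≠ 0 → D l = 0 := by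
    intro x y l hy hl
    rcases cases_of_E ε E hE _ _ l (show E (e.symm x) (e.symm y) l ≠ 0 from hl) with ⟨h0, _, _⟩ | ⟨_, _, _, hlast⟩
    · exact absurd h0 (hfirst_of_le y hy)
    · rw [hlast]; exact hDlast
  -- (i-b) valuations vanish off the strip
  have hzeroV : ∀ (x y : Fin ((m + 1) * m)) (l : Fin (K + 1)), m ≤ (y : ℕ) → v' x y l = 0 := by
    intro x y l hy
    show V (e.symm x) (e.symm y) l = 0
    exact V_slot v V hV _ _ (hfirst_of_le y hy) l
  -- (i-c) private menus: a row is available to at most one strip column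
  have hmenu : ∀ (x y y' : Fin ((m + 1) * m)) (l l' : Fin (K + 1)), (y : ℕ) < m → (y' : ℕ) < m →
      ε' x y l ≠ 0 → ε' x y' l' ≠ 0 → y = y' := by
    intro x y y' l l' hy hy' hl hl'
    have hl1 : E (e.symm x) (e.symm y) l ≠ 0 := hl
    have hl2 : E (e.symm x) (e.symm y') l' ≠ 0 := hl'
    rcases cases_of_E ε E hE _ _ l hl1 with ⟨h0, h1, _⟩ | ⟨h0, _⟩
    · rcases cases_of_E ε E hE _ _ l' hl2 with ⟨h0', h1', _⟩ | ⟨h0', _⟩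
      · apply Fin.ext
        rw [hcoord y, hcoord y', h0, h0']
        have : ((e.symm y).2 : ℕ) = ((e.symm y').2 : ℕ) := by omega
        rw [this]
      · exact absurd (hfirst_of_lt y' hy') h0'
    · exact absurd (hfirst_of_lt y hy) h0
  -- (i-d) parking columns have at most two present rows: the spare row and the cell
  have hdeg : ∀ y : Fin ((m + 1) * m), m ≤ (y : ℕ) → (Finset.univ.filter fun x => ∃ l, ε' x y l ≠ 0).card ≤ 2 := by
    intro y hy
    set c := e.symm y with hc
    have hsub : (Finset.univ.filter fun x => ∃ l, ε' x y l ≠ 0) ⊆ ({e ((0 : Fin (m + 1)), c.2), e c} : Finset _) := by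
      intro x hx
      rw [Finset.mem_filter] at hx
      obtain ⟨l, hl⟩ := hx.2
      have hl' : E (e.symm x) c l ≠ 0 := by simpa [ε', hc] using hl
      rw [Finset.mem_insert, Finset.mem_singleton]
      have hx' : x = e (e.symm x) := (Equiv.apply_symm_apply e x).symm
      rcases cases_of_E ε E hE (e.symm x) c l hl' with ⟨h0, _⟩ | ⟨_, h2, h1, _⟩
      · exact absurd h0 (by rw [hc]; exact hfirst_of_le y hy)
      · rcases h1 with h1 | h1
        · left; rw [hx']; congr 1; exact Prod.ext (Fin.ext h1) h2
        · right; rw [hx']; congr 1; exact Prod.ext h1 h2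
    calc (Finset.univ.filter fun x => ∃ l, ε' x y l ≠ 0).card ≤ ({e ((0 : Fin (m + 1)), c.2), e c} : Finset _).card :=
          Finset.card_le_card hsub
      _ ≤ 2 := by
          refine (Finset.card_insert_le _ _).trans ?_
          simp
  -- (ii) the big permutation of an original permutation
  have hlift : ∀ σ : Equiv.Perm (Fin m), ∃ W : Equiv.Perm (Fin (m + 1) × Fin m), ∀ u, W u =
      if h : u.1 = 0 then (Fin.succ u.2, σ u.2) else (if σ (u.1.pred h) = u.2 then ((0 : Fin (m + 1)), u.2) else u) := by
    intro σ
    let F : Fin (m + 1) × Fin m → Fin (m + 1) × Fin m := fun u =>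
      if h : u.1 = 0 then (Fin.succ u.2, σ u.2) else (if σ (u.1.pred h) = u.2 then ((0 : Fin (m + 1)), u.2) else u)
    have hinj : Function.Injective F := liftFun_injective σ F (fun _ => rfl)
    exact ⟨Equiv.ofBijective F (Finite.injective_iff_bijective.mp hinj), fun u => rfl⟩
  choose W hW using hlift
  -- the class map of a term and the big term
  let L : (Equiv.Perm (Fin m) × (Fin m → Fin K)) → Fin (m + 1) × Fin m → Fin (K + 1) := fun q u =>
    if (u.1 : ℕ) = 0 then Fin.castSucc (q.2 u.2) else Fin.last K
  let T : (Equiv.Perm (Fin m) × (Fin m → Fin K)) → Equiv.Perm (Fin ((m + 1) * m)) × (Fin ((m + 1) * m) → Fin (K + 1)) :=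
    fun q => (e.permCongr (W q.1), fun y => L q (e.symm y))
  -- (iii) entries picked up by the big term of `q`
  have hentries : ∀ (q : Equiv.Perm (Fin m) × (Fin m → Fin K)) (u : Fin (m + 1) × Fin m),
      (E (W q.1 u) u (L q u) = if (u.1 : ℕ) = 0 then ε (q.1 u.2) u.2 (q.2 u.2) else 1) ∧
      (V (W q.1 u) u (L q u) = if (u.1 : ℕ) = 0 then v (q.1 u.2) u.2 (q.2 u.2) else 0) := by
    intro q u
    have hL : L q u = if (u.1 : ℕ) = 0 then Fin.castSucc (q.2 u.2) else Fin.last K := rfl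
    by_cases hu : (u.1 : ℕ) = 0
    · -- strip column
      have hu' : u.1 = 0 := Fin.ext hu
      have hWu : W q.1 u = (Fin.succ u.2, q.1 u.2) := by rw [hW, dif_pos hu']
      have hueq : u = ((0 : Fin (m + 1)), u.2) := Prod.ext hu' rfl
      rw [hL, if_pos hu, if_pos hu, if_pos hu, hWu]
      refine ⟨?_, ?_⟩
      · conv_lhs => rw [hueq]
        exact E_cell ε E hE (q.1 u.2) u.2 (q.2 u.2)
      · conv_lhs => rw [hueq]
        exact V_cell v V hV (q.1 u.2) u.2 (q.2 u.2)
    · -- parking slot: the row is the spare row or the cell itself, class `last`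
      rw [hL, if_neg hu, if_neg hu, if_neg hu]
      have hu' : u.1 ≠ 0 := fun hh => hu (by rw [hh]; rfl)
      have hWu : W q.1 u = ((0 : Fin (m + 1)), u.2) ∨ W q.1 u = u := by
        rw [hW, dif_neg hu']
        by_cases hs : q.1 (u.1.pred hu') = u.2
        · rw [if_pos hs]; exact Or.inl rfl
        · rw [if_neg hs]; exact Or.inr rfl
      exact ⟨E_slot ε E hE _ u hu hWu, V_slot v V hV _ u hu _⟩
  -- (iv) presence and weight of the big term
  have hpres : ∀ q : Equiv.Perm (Fin m) × (Fin m → Fin K), termSign ε q ≠ 0 → termSign ε' (T q) ≠ 0 := by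
    intro q hq
    rw [termSign_ne_zero_iff]
    intro y
    have hq' := (termSign_ne_zero_iff ε q).1 hq
    show E (e.symm ((e.permCongr (W q.1)) y)) (e.symm y) (L q (e.symm y)) ≠ 0
    rw [Equiv.permCongr_apply, Equiv.symm_apply_apply, (hentries q (e.symm y)).1]
    split_ifs
    · exact hq' _
    · exact one_ne_zero
  have hL0 : ∀ (q : Equiv.Perm (Fin m) × (Fin m → Fin K)) a, L q ((0 : Fin (m + 1)), a) = Fin.castSucc (q.2 a) := fun q a => if_pos rfl
  have hL1 : ∀ (q : Equiv.Perm (Fin m) × (Fin m → Fin K)) (t a : Fin m), L q (t.succ, a) = Fin.last K := fun q t a => if_neg (by simp)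
  have hweight : ∀ (q : Equiv.Perm (Fin m) × (Fin m → Fin K)) (θ₀ : ℤ),
      tropWeight D v' θ₀ (T q) = tropWeight d v θ₀ q := by
    intro q θ₀
    unfold tropWeight
    have hs1 : ∑ y : Fin ((m + 1) * m), (D ((T q).2 y) : ℤ) = ∑ i : Fin m, (d (q.2 i) : ℤ) := by
      show ∑ y, (D (L q (e.symm y)) : ℤ) = _
      rw [← Equiv.sum_comp e (fun y => (D (L q (e.symm y)) : ℤ))]
      simp only [Equiv.symm_apply_apply]
      rw [Fintype.sum_prod_type, Fin.sum_univ_succ]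
      simp only [hL0, hL1, hDcast, hDlast, Nat.cast_zero, Finset.sum_const_zero, add_zero]
    have hs2 : ∑ y : Fin ((m + 1) * m), v' ((T q).1 y) y ((T q).2 y) = ∑ i : Fin m, v (q.1 i) i (q.2 i) := by
      show ∑ y, V (e.symm ((e.permCongr (W q.1)) y)) (e.symm y) (L q (e.symm y)) = _
      rw [← Equiv.sum_comp e (fun y => V (e.symm ((e.permCongr (W q.1)) y)) (e.symm y) (L q (e.symm y)))]
      simp only [Equiv.permCongr_apply, Equiv.symm_apply_apply]
      rw [Finset.sum_congr rfl (fun u _ => (hentries q u).2)]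
      rw [Fintype.sum_prod_type, Fin.sum_univ_succ]
      simp only [Fin.val_zero, if_true, Fin.val_succ, Nat.succ_ne_zero, if_false, Finset.sum_const_zero, add_zero]
    rw [hs1, hs2]
  -- (v) every present big term is the big term of a present original term
  have hsurj : ∀ Q : Equiv.Perm (Fin ((m + 1) * m)) × (Fin ((m + 1) * m) → Fin (K + 1)),
      termSign ε' Q ≠ 0 → ∃ q, termSign ε q ≠ 0 ∧ T q = Q := by
    intro Q hQ
    have hQ' := (termSign_ne_zero_iff ε' Q).1 hQ
    set S : Equiv.Perm (Fin (m + 1) × Fin m) := e.symm.permCongr Q.1 with hS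
    set Lc : Fin (m + 1) × Fin m → Fin (K + 1) := fun u => Q.2 (e u) with hLc
    have hSu : ∀ u, S u = e.symm (Q.1 (e u)) := by
      intro u; rw [hS, Equiv.permCongr_apply, Equiv.symm_symm]
    have hpresu : ∀ u, E (S u) u (Lc u) ≠ 0 := by
      intro u
      have := hQ' (e u)
      change E (e.symm (Q.1 (e u))) (e.symm (e u)) (Q.2 (e u)) ≠ 0 at this
      rwa [Equiv.symm_apply_apply, ← hSu] at this
    have hc := fun u => cases_of_E ε E hE (S u) u (Lc u) (hpresu u)
    -- step 1: strip columns hold cells of their own original column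
    have hstripS : ∀ c : Fin m, S ((0 : Fin (m + 1)), c) = (Fin.succ c, (S ((0 : Fin (m + 1)), c)).2) ∧
        ∃ hl : ((Lc ((0 : Fin (m + 1)), c) : Fin (K + 1)) : ℕ) < K,
          ε (S ((0 : Fin (m + 1)), c)).2 c ⟨(Lc ((0 : Fin (m + 1)), c) : ℕ), hl⟩ ≠ 0 := by
      intro c
      rcases hc ((0 : Fin (m + 1)), c) with ⟨_, h1, hl, hε⟩ | ⟨h0, _⟩
      · refine ⟨Prod.ext (Fin.ext ?_) rfl, hl, hε⟩
        rw [h1]; simp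
      · exact absurd rfl h0
    -- step 2: parking slots hold the spare row or their own cell, at the last class
    have hslotS : ∀ u : Fin (m + 1) × Fin m, u.1 ≠ 0 →
        (S u = ((0 : Fin (m + 1)), u.2) ∨ S u = u) ∧ Lc u = Fin.last K := by
      intro u hu
      have hu' : (u.1 : ℕ) ≠ 0 := fun hh => hu (Fin.ext hh)
      rcases hc u with ⟨h0, _⟩ | ⟨_, h2, h1, hl⟩
      · exact absurd h0 hu'
      · refine ⟨?_, hl⟩
        rcases h1 with h1 | h1
        · left; exact Prod.ext (Fin.ext h1) h2
        · right; exact Prod.ext h1 h2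
    -- step 3: the strip row map is injective
    let σ₀ : Fin m → Fin m := fun c => (S ((0 : Fin (m + 1)), c)).2
    have hS0 : ∀ c, S ((0 : Fin (m + 1)), c) = (Fin.succ c, σ₀ c) := fun c => (hstripS c).1
    -- a parked spare row: if the strip column `b` holds the cell `(a, b)`, the slot of that cell holds the spare row of `a`
    have hpark : ∀ b : Fin m, S (Fin.succ b, σ₀ b) = ((0 : Fin (m + 1)), σ₀ b) := by
      intro b
      have hne : Fin.succ b ≠ (0 : Fin (m + 1)) := Fin.succ_ne_zero b
      rcases (hslotS (Fin.succ b, σ₀ b) hne).1 with hh | hh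
      · exact hh
      · exfalso
        have : (Fin.succ b, σ₀ b) = ((0 : Fin (m + 1)), b) := S.injective (by rw [hh, hS0])
        exact hne (congrArg Prod.fst this)
    have hinj : Function.Injective σ₀ := by
      intro c c' hcc
      have h1 := hpark c
      have h2 := hpark c'
      rw [hcc] at h1
      have : (Fin.succ c, σ₀ c') = (Fin.succ c', σ₀ c') := S.injective (by rw [h1, h2])
      exact Fin.succ_inj.mp (congrArg Prod.fst this)
    -- step 4: the permutation
    let σ : Equiv.Perm (Fin m) := Equiv.ofBijective σ₀ (Finite.injective_iff_bijective.mp hinj)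
    have hσ : ∀ c, σ c = σ₀ c := fun c => rfl
    -- step 5: `S = W σ`
    have hSW : ∀ u, S u = W σ u := by
      intro u
      rw [hW]
      by_cases hu : u.1 = 0
      · rw [dif_pos hu]
        have hueq : u = ((0 : Fin (m + 1)), u.2) := Prod.ext hu rfl
        conv_lhs => rw [hueq]
        rw [hS0, hσ]
      · rw [dif_neg hu]
        set b : Fin m := u.1.pred hu with hb
        have hub : Fin.succ b = u.1 := Fin.succ_pred u.1 hu
        by_cases hs : σ b = u.2
        · rw [if_pos hs]
          rw [hσ] at hs
          have hueq : u = (Fin.succ b, σ₀ b) := Prod.ext hub.symm hs.symm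
          rw [hueq]; exact hpark b
        · rw [if_neg hs]
          rcases (hslotS u hu).1 with hh | hh
          · exfalso
            -- the cell `u` must then be held by some column `w`; only its strip column or its own slot accept it
            set w := S.symm u with hw
            have hSw : S w = u := by rw [hw]; exact S.apply_symm_apply u
            rcases hc w with ⟨h0, h1, _⟩ | ⟨h0, h2, h1, _⟩
            · -- `w` is the strip column `(0, b)`: then `σ b = u.2`
              rw [hSw] at h1
              have hw0 : w = ((0 : Fin (m + 1)), w.2) := Prod.ext (Fin.ext h0) rfl
              have hwb : w.2 = b := by
                apply Fin.succ_inj.mp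
                rw [hub]; exact Fin.ext (by rw [Fin.val_succ]; exact h1.symm)
              apply hs
              rw [hσ]
              have hwb' : w = ((0 : Fin (m + 1)), b) := by rw [hw0, hwb]
              have := hS0 b
              rw [← hwb', hSw] at this
              rw [this]
            · -- `w` is a slot holding `u`: it is the slot of `u` itself, so `S u = u ≠ (0, u.2)`
              rw [hSw] at h2 h1
              rcases h1 with h1 | h1
              · exact hu (Fin.ext h1)
              · have hwu : w = u := (Prod.ext h1 h2).symm
                rw [hwu] at hSw
                rw [hSw] at hh
                exact hu (congrArg Prod.fst hh)
          · exact hh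
    -- step 6: classes and presence of the original term
    let lam : Fin m → Fin K := fun c => ⟨(Lc ((0 : Fin (m + 1)), c) : ℕ), (hstripS c).2.1⟩
    refine ⟨(σ, lam), ?_, ?_⟩
    · rw [termSign_ne_zero_iff]
      intro c
      rw [hσ]
      exact (hstripS c).2.2
    · refine Prod.ext ?_ ?_
      · -- permutations
        ext y : 1
        show (e.permCongr (W σ)) y = Q.1 y
        rw [Equiv.permCongr_apply, ← hSW, hSu, Equiv.apply_symm_apply, Equiv.apply_symm_apply]
      · funext y
        show L (σ, lam) (e.symm y) = Q.2 y
        have hy : Q.2 y = Lc (e.symm y) := by rw [hLc]; simp only; rw [Equiv.apply_symm_apply]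
        rw [hy]
        set u := e.symm y with hu
        by_cases h0 : (u.1 : ℕ) = 0
        · have hueq : u = ((0 : Fin (m + 1)), u.2) := Prod.ext (Fin.ext h0) rfl
          rw [hueq, hL0]
          exact Fin.ext rfl
        · have h0' : u.1 ≠ 0 := fun hh => h0 (by rw [hh]; rfl)
          rw [(hslotS u h0').2]
          exact if_neg h0
  -- (vi) degree control: the strip column `c` accepts only cells `(a, c)` of present original entries `(a, c)`
  have hdegstrip : ∀ (y : Fin ((m + 1) * m)) (hy : (y : ℕ) < m),
      (Finset.univ.filter fun x => ∃ l, ε' x y l ≠ 0).card ≤ (Finset.univ.filter fun a => ∃ l, ε a ⟨y, hy⟩ l ≠ 0).card := by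
    intro y hy
    have hc0 : ((e.symm y).1 : ℕ) = 0 := hfirst_of_lt y hy
    have hc2 : (e.symm y).2 = ⟨y, hy⟩ := by
      apply Fin.ext; have h1 := hcoord y; have hz : m * ((e.symm y).1 : ℕ) = 0 := by rw [hc0, Nat.mul_zero]
      show ((e.symm y).2 : ℕ) = (y : ℕ); omega
    refine Finset.card_le_card_of_injOn (fun x => (e.symm x).2) ?_ ?_
    · intro x hx
      rw [Finset.mem_coe, Finset.mem_filter] at hx
      obtain ⟨l, hl⟩ := hx.2
      rcases cases_of_E ε E hE (e.symm x) (e.symm y) l hl with ⟨_, _, hl', hε⟩ | ⟨h0, _⟩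
      · rw [Finset.mem_coe, Finset.mem_filter]
        refine ⟨Finset.mem_univ _, ⟨(l : ℕ), hl'⟩, ?_⟩
        rw [← hc2]; exact hε
      · exact absurd hc0 h0
    · intro x hx x' hx' hxx
      rw [Finset.mem_coe, Finset.mem_filter] at hx hx'
      obtain ⟨l, hl⟩ := hx.2
      obtain ⟨l', hl'⟩ := hx'.2
      rcases cases_of_E ε E hE (e.symm x) (e.symm y) l hl with ⟨_, h1, _⟩ | ⟨h0, _⟩
      · rcases cases_of_E ε E hE (e.symm x') (e.symm y) l' hl' with ⟨_, h1', _⟩ | ⟨h0', _⟩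
        · apply e.symm.injective
          exact Prod.ext (Fin.ext (h1.trans h1'.symm)) hxx
        · exact absurd hc0 h0'
      · exact absurd hc0 h0
  -- (vii) the lift and the transfer of row bounds
  refine ⟨D, v', ε', hstrip, hzeroV, hmenu, hdeg, hdegstrip, fun B hrow n θ p hθ hdom hstep => ?_⟩
  refine hrow n θ (fun k => T (p k)) hθ ?_ ?_
  · intro k
    refine ⟨hpres (p k) (hdom k).1, fun Q hne hQ => ?_⟩
    obtain ⟨q, hq, rfl⟩ := hsurj Q hQ
    have hne' : q ≠ p k := fun hh => hne (by rw [hh])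
    rw [hweight, hweight]
    exact (hdom k).2 q hne' hq
  · -- consecutive big terms are distinct: the permutation and the classes are read off the strip columns
    intro k hk
    apply hstep k
    have h1 : W (p k.castSucc).1 = W (p k.succ).1 := by
      have := congrArg Prod.fst hk
      exact (Equiv.permCongr e).injective this
    have hσeq : (p k.castSucc).1 = (p k.succ).1 := by
      ext c : 1
      have hh : W (p k.castSucc).1 ((0 : Fin (m + 1)), c) = W (p k.succ).1 ((0 : Fin (m + 1)), c) := by rw [h1]
      rw [hW, hW, dif_pos rfl, dif_pos rfl] at hh
      exact congrArg Prod.snd hh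
    have h2 : ∀ y, L (p k.castSucc) (e.symm y) = L (p k.succ) (e.symm y) := fun y => by
      exact congrFun (congrArg Prod.snd hk) y
    refine Prod.ext hσeq (funext fun c => ?_)
    have hc := h2 (e ((0 : Fin (m + 1)), c))
    rw [Equiv.symm_apply_apply, hL0, hL0] at hc
    exact Fin.castSucc_injective _ hc

end OneCut

end Summit.ValiantsHypothesis.ValiantsHypothesis.Theorems.KPlusLogSqLaw
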